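import Summits.NavierStokesRegularity.NavierStokesRegularity.Theorems.ExtremiserTransienceZoomCompactness
import Summits.NavierStokesRegularity.NavierStokesRegularity.Theorems.ExtremiserTransiencePerFlowScaleLockOfEnstrophyRate
import Literature.Analysis.FluidPDE.BoundedMildSmoothRemainder
import Literature.Analysis.FluidPDE.KNSSProp41MildHolds
import HarnessLib

/-!
# Route `ExtremiserTransience`, crux `NearExtremalTransiencePerFlow` (stmt-NavierStokesRegularity-26567),
# LINE g7-δ «coherent member selection», stub T2 `stub_zoomPackage` — part 2: UNIFORM `Cᵏ` BOUNDS OF THE ZOOMED SLICES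

`--supports stmt-NavierStokesRegularity-26567` (helper; LINE δ = `Cruxes/…/Lines/member_selection.lean`, PASS idea-crit-4; unregistered
stubs ⇒ helper). Author: prover seat `ns-net-p2` (g0).

The `NearExtremalFamily` clause of T2 that carries analytic content is the UNIFORM bound of ALL spatial derivatives of the zoomed
slices `v n y = (Mb n)⁻¹ • u (t n) ((ν / Mb n) • y)` (`t n → T` late times of a Type-I singular classical Leray–Hopf flow,
`‖u (t n)‖ ≤ Mb n`).  Proved here:

* `iteratedFDeriv_bound_of_oseenWindow` — KNSS 2009 Prop. 4.1 (4.6) (tree: `KNSS2009_prop41_mild_holds`) in the form «a jointly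
  continuous, bounded (`≤ N`), weakly divergence-free, Oseen-forward-mild field on `[0,S] × ℝ³` has `‖∇ᵏu(t⋆)‖ ≤ Λ(k,N,S,t⋆)` at any
  interior time `t⋆`» — the constant is UNIFORM over all such fields (clamp to a drift-mild field,
  `isKNSSDriftMild_clamp_of_oseenForward`, sub-window of length `min(t⋆/2, ε/(2(N²+1)))`);
* `zoomSlices_iteratedFDeriv_le` — for `n ≥ n₀` (late times `t n > T/2`) and every `k`: `‖∇ᵏ(v n)‖ ≤ Λ k` with `Λ k` independent of
  `n`: the slice `u (t n)` is the time-`s₀ = −c₀²/2` slice of the unit-viscosity zoom with vertex `τ n = t n + ν(c₀²/2)/(Mb n)²`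
  (`c₀` = Leray's lower-rate constant, `PerFlow.lerayLowerRate_of_not_extends`), a classical solution on its window
  (`zoom_isClassical_window`) satisfying the Oseen identity there (`zoom_oseen_window`) and bounded by `K√2/c₀·√2` on `[2s₀, s₀/2]`
  (eventual Type-I rate + slab bound `exists_forall_norm_le_of_tao2011`, as in part 1 `…MemberSelectionZoomCompact`).
HONEST FRAMING: parabolic-regularity bookkeeping for hypothetical Type-I singular flows; nothing about Navier–Stokes regularity or
blow-up is proved; no summit is proved by a line. [cite: KochNadirashviliSereginSverak2009, Prop. 4.1 (4.6) (arXiv:0709.3599 §4 p. 8)]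
-/

noncomputable section

open scoped Topology
open Filter Set MeasureTheory Function Metric
open Literature.Analysis Literature.Analysis.FluidPDE Literature.Analysis.UnboundedOperators

namespace Summit.NavierStokesRegularity.NavierStokesRegularity.Theorems.ExtremiserTransience

-- the problem directory repeats the summit name (`NavierStokesRegularity/NavierStokesRegularity`)
set_option linter.dupNamespace false

/-- **KNSS Prop. 4.1 on a window, uniform form.**  For every order `k`, bound `N ≥ 0` and window data `0 < t⋆ < S` there is
`Λ ≥ 0` such that every jointly continuous field `u` on `[0,S] × ℝ³` with `‖u‖ ≤ N`, weakly divergence-free slices and the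
forward Oseen identity `u(t) = e^{(t−s)Δ}u(s) − B¹_s(u,u)(t)` (`0 ≤ s < t ≤ S`) has `‖∇ᵏ u(t⋆) x‖ ≤ Λ` for all `x`.
[cite: KochNadirashviliSereginSverak2009, Prop. 4.1 (4.6) (arXiv:0709.3599 §4 p. 8)] -/
theorem iteratedFDeriv_bound_of_oseenWindow (k : ℕ) {N S tstar : ℝ} (hN : 0 ≤ N) (htstar : 0 < tstar)
    (htS : tstar < S) :
    ∃ Λ : ℝ, 0 ≤ Λ ∧ ∀ (u : ℝ → EuclideanSpace ℝ (Fin 3) → EuclideanSpace ℝ (Fin 3)),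
      ContinuousOn (uncurry u) (Icc 0 S ×ˢ univ) → (∀ t ∈ Icc 0 S, ∀ x, ‖u t x‖ ≤ N) →
      (∀ t ∈ Icc 0 S, IsWeaklyDivFree (u t)) →
      (∀ s t : ℝ, 0 ≤ s → s < t → t ≤ S → ∀ x, u t x = heatExtension (u s) (t - s) x - oseenDuhamel 1 s u u t x) →
      ∀ x, ‖iteratedFDeriv ℝ k (u tstar) x‖ ≤ Λ := by
  obtain ⟨ε, hε, C, hC0, hP⟩ := KNSS2009_prop41_mild_holds k
  have hS : 0 < S := htstar.trans htS
  -- the sub-window length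
  set d : ℝ := min (tstar / 2) (ε / (2 * (N ^ 2 + 1))) with hd
  have hdpos : 0 < d := lt_min (half_pos htstar) (by positivity)
  have hdt : d ≤ tstar / 2 := min_le_left _ _
  have hdε : N ^ 2 * d < ε := by
    have h1 : d ≤ ε / (2 * (N ^ 2 + 1)) := min_le_right _ _
    have h2 : N ^ 2 * d ≤ N ^ 2 * (ε / (2 * (N ^ 2 + 1))) := mul_le_mul_of_nonneg_left h1 (sq_nonneg N)
    have h3 : N ^ 2 * (ε / (2 * (N ^ 2 + 1))) < ε := by
      rw [mul_div_assoc', div_lt_iff₀ (by positivity)]; nlinarith [sq_nonneg N]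
    exact h2.trans_lt h3
  have hdk : 0 < d ^ ((k : ℝ) / 2) := Real.rpow_pos_of_pos hdpos _
  refine ⟨C * N / d ^ ((k : ℝ) / 2), by positivity, fun u hcont hK hdiv hmild x => ?_⟩
  have hV := isKNSSDriftMild_clamp_of_oseenForward hS hcont hK hdiv hmild
  obtain ⟨-, hwin⟩ := hP hV
  have hs_mem : tstar - d ∈ Ioo 0 S := ⟨by linarith, by linarith⟩
  have ht_mem : tstar ∈ Ioo (tstar - d) S := ⟨by linarith, htS⟩
  have hNd : N ^ 2 * (tstar - (tstar - d)) < ε := by rw [show tstar - (tstar - d) = d by ring]; exact hdε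
  have hder := (hwin (tstar - d) hs_mem tstar ht_mem hNd).1 x
  have hclamp : max 0 (min tstar S) = tstar := by rw [min_eq_left htS.le, max_eq_right htstar.le]
  have hslice : (fun y => u (max 0 (min tstar S)) y) = u tstar := by funext y; rw [hclamp]
  rw [hslice, show tstar - (tstar - d) = d by ring] at hder
  rw [le_div_iff₀ hdk, mul_comm]
  exact hder

/-- **Uniform `Cᵏ` bounds of the zoomed slices.**  For a classical Leray–Hopf flow on `[0,T)` from rapidly decaying data with an
eventual Type-I rate and no smooth extension past `T`, late times `t n → T` and height bounds `‖u (t n) ·‖ ≤ Mb n`: there is `n₀`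
such that for every `k` some `Λ` bounds `‖∇ᵏ[(Mb n)⁻¹ • u (t n) ((ν/Mb n) • ·)]‖` for all `n ≥ n₀` (uniformly in `n` and `x`).
[cite: KochNadirashviliSereginSverak2009, Prop. 4.1 (4.6) (arXiv:0709.3599 §4 p. 8)] -/
theorem zoomSlices_iteratedFDeriv_le {C ν T : ℝ} {u : ℝ → EuclideanSpace ℝ (Fin 3) → EuclideanSpace ℝ (Fin 3)}
    {p : ℝ → EuclideanSpace ℝ (Fin 3) → ℝ} (hν : 0 < ν) (hT : 0 < T)
    (hsol : IsClassicalNSSolutionOn (Set.Ico 0 T) ν 0 u p) (hLH : IsLerayHopfOn T ν 0 (u 0) u)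
    (hdec : HasRapidSpatialDecay (u 0)) (hrate : ∀ᶠ t in 𝓝[<] T, ∀ x, Real.sqrt (T - t) * ‖u t x‖ ≤ C * Real.sqrt ν)
    (hext : ¬ HasSmoothExtensionPast ν 0 u T) {t Mb : ℕ → ℝ} (ht : ∀ n, t n ∈ Set.Ico 0 T)
    (htT : Tendsto t atTop (𝓝 T)) (hMb : ∀ n x, ‖u (t n) x‖ ≤ Mb n) :
    ∃ n₀ : ℕ, ∀ k : ℕ, ∃ Λ : ℝ, 0 ≤ Λ ∧ ∀ n, n₀ ≤ n → ∀ x,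
      ‖iteratedFDeriv ℝ k (fun y => (Mb n)⁻¹ • u (t n) ((ν / Mb n) • y)) x‖ ≤ Λ := by
  have hsν : 0 < Real.sqrt ν := Real.sqrt_pos.2 hν
  have hTt : ∀ n, 0 < T - t n := fun n => sub_pos.2 (ht n).2
  -- Leray's lower rate and its consequences (as in part 1)
  obtain ⟨c₀, hc₀, hler⟩ := DepletionLadder.PerFlow.lerayLowerRate_of_not_extends hν hT hsol hLH hdec hext
  have hMbL : ∀ n, c₀ * Real.sqrt ν ≤ Real.sqrt (T - t n) * Mb n := fun n => by
    obtain ⟨x, hx⟩ := hler (t n) (ht n)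
    exact hx.trans (mul_le_mul_of_nonneg_left (hMb n x) (Real.sqrt_nonneg _))
  have hMbpos : ∀ n, 0 < Mb n := fun n => by
    by_contra h
    have h1 : Real.sqrt (T - t n) * Mb n ≤ 0 := mul_nonpos_of_nonneg_of_nonpos (Real.sqrt_nonneg _) (not_lt.1 h)
    linarith [hMbL n, mul_pos hc₀ hsν]
  have hsq : ∀ n, ν * c₀ ^ 2 ≤ (T - t n) * Mb n ^ 2 := fun n => by
    have h := pow_le_pow_left₀ (by positivity) (hMbL n) 2
    rw [mul_pow, mul_pow, Real.sq_sqrt hν.le, Real.sq_sqrt (hTt n).le] at h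
    linarith
  -- the eventual Type-I rate on `(t⋆, T)`; slab bound on `[0, T₁]`
  obtain ⟨tstar, htstar, hsub⟩ := mem_nhdsLT_iff_exists_Ioo_subset.1 hrate
  have htstarT : tstar < T := htstar
  set T₁ : ℝ := max ((tstar + T) / 2) (T / 2) with hT₁def
  have hT₁T : T₁ < T := max_lt (by linarith [htstarT]) (by linarith)
  have hT₁0 : 0 < T₁ := lt_of_lt_of_le (by linarith) (le_max_right _ _)
  have hT₁star : tstar < T₁ := lt_of_lt_of_le (by linarith [htstarT]) (le_max_left _ _)
  have hbdd : ∀ T₂ ∈ Ioo 0 T, ∃ M : ℝ, ∀ t ∈ Icc 0 T₂, ∀ y, ‖u t y‖ ≤ M :=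
    exists_forall_norm_le_of_tao2011 tao2011_hasBoundedSobolevNormsOn_holds hν hsol hLH hdec
  obtain ⟨U, hU⟩ := hbdd T₁ ⟨hT₁0, hT₁T⟩
  have hU0 : 0 ≤ U := (norm_nonneg _).trans (hU 0 ⟨le_rfl, hT₁0.le⟩ 0)
  have htypeI : ∀ t' : ℝ, T₁ < t' → t' < T → ∀ x, ‖u t' x‖ ≤ C * Real.sqrt ν / Real.sqrt (T - t') := by
    intro t' h1 h2 x
    have h := hsub ⟨hT₁star.trans h1, h2⟩ x
    rw [le_div_iff₀ (Real.sqrt_pos.2 (sub_pos.2 h2)), mul_comm]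
    exact h
  have hC0 : 0 ≤ C := by
    have h := hsub (a := (T₁ + T) / 2) ⟨by linarith, by linarith⟩ 0
    have h1 : 0 ≤ Real.sqrt (T - (T₁ + T) / 2) * ‖u ((T₁ + T) / 2) 0‖ := by positivity
    nlinarith
  -- the zoom data
  set s₀ : ℝ := -(c₀ ^ 2 / 2) with hs₀def
  have hs₀ : s₀ < 0 := by rw [hs₀def]; exact neg_neg_of_pos (by positivity)
  set τ : ℕ → ℝ := fun n => t n - ν * s₀ / Mb n ^ 2 with hτdef
  have hτt : ∀ n, τ n + ν * s₀ / Mb n ^ 2 = t n := fun n => by simp only [hτdef]; ring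
  have hτge : ∀ n, t n < τ n := fun n => by
    have : 0 < ν * (c₀ ^ 2 / 2) / Mb n ^ 2 := by have := hMbpos n; positivity
    simp only [hτdef, hs₀def]
    rw [show ν * -(c₀ ^ 2 / 2) / Mb n ^ 2 = -(ν * (c₀ ^ 2 / 2) / Mb n ^ 2) by ring]
    linarith
  have hτpos : ∀ n, 0 < τ n := fun n => lt_of_le_of_lt (ht n).1 (hτge n)
  have hTτ : ∀ n, (T - t n) / 2 ≤ T - τ n := fun n => by
    have hM2 : 0 < Mb n ^ 2 := pow_pos (hMbpos n) 2
    have h1 : ν * (c₀ ^ 2 / 2) / Mb n ^ 2 ≤ (T - t n) / 2 := by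
      rw [div_le_iff₀ hM2]; nlinarith [hsq n]
    simp only [hτdef, hs₀def]
    rw [show ν * -(c₀ ^ 2 / 2) / Mb n ^ 2 = -(ν * (c₀ ^ 2 / 2) / Mb n ^ 2) by ring]
    linarith
  have hτT : ∀ n, τ n < T := fun n => by linarith [hTτ n, hTt n]
  set K : ℝ := max C (U * Real.sqrt T / Real.sqrt ν) with hKdef
  have hK0 : 0 ≤ K := hC0.trans (le_max_left _ _)
  -- the zoom Type-I bound (centre `0`): `√(−s) ‖(Mb n)⁻¹ u(τ n + ν s/(Mb n)², (ν/Mb n) y)‖ ≤ K`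
  have hzoomI : ∀ n, ∀ s : ℝ, -(τ n * Mb n ^ 2 / ν) < s → s < 0 → ∀ z,
      Real.sqrt (-s) * ‖(Mb n)⁻¹ • u (τ n + ν * s / Mb n ^ 2) ((ν / Mb n) • z)‖ ≤ K := by
    intro n s hs1 hs2 z
    have hM := hMbpos n
    have hM2 : 0 < Mb n ^ 2 := pow_pos hM 2
    set t' : ℝ := τ n + ν * s / Mb n ^ 2 with ht'def
    have ht'pos : 0 < t' := by
      have : -(τ n) < ν * s / Mb n ^ 2 := by
        rw [lt_div_iff₀ hM2]
        have := mul_lt_mul_of_pos_left hs1 hν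
        have e : ν * -(τ n * Mb n ^ 2 / ν) = -(τ n) * Mb n ^ 2 := by field_simp
        linarith [e ▸ this]
      simp only [ht'def]; linarith
    have ht'τ : t' < τ n := by
      have : ν * s / Mb n ^ 2 < 0 := div_neg_of_neg_of_pos (mul_neg_of_pos_of_neg hν hs2) hM2
      simp only [ht'def]; linarith
    have hns : 0 < -s := by linarith
    rw [norm_smul, norm_inv, Real.norm_eq_abs, abs_of_pos hM]
    rcases le_or_gt t' T₁ with h1 | h1
    · have hsT : -s ≤ T * Mb n ^ 2 / ν := by
        have e : -s = (τ n - t') * Mb n ^ 2 / ν := by simp only [ht'def]; field_simp; ring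
        rw [e]
        gcongr
        linarith [hτT n]
      have hsqrt : Real.sqrt (-s) ≤ Mb n * Real.sqrt T / Real.sqrt ν := by
        calc Real.sqrt (-s) ≤ Real.sqrt (T * Mb n ^ 2 / ν) := Real.sqrt_le_sqrt hsT
          _ = Mb n * Real.sqrt T / Real.sqrt ν := by
              rw [Real.sqrt_div' _ hν.le, Real.sqrt_mul hT.le, Real.sqrt_sq hM.le]; ring
      calc Real.sqrt (-s) * ((Mb n)⁻¹ * ‖u t' ((ν / Mb n) • z)‖)
          ≤ (Mb n * Real.sqrt T / Real.sqrt ν) * ((Mb n)⁻¹ * U) := by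
            gcongr
            exact hU t' ⟨ht'pos.le, h1⟩ _
        _ = U * Real.sqrt T / Real.sqrt ν := by field_simp
        _ ≤ K := le_max_right _ _
    · have ht'T : t' < T := ht'τ.trans (hτT n)
      have hTt' : ν * (-s) / Mb n ^ 2 ≤ T - t' := by
        have e : T - t' = (T - τ n) + ν * (-s) / Mb n ^ 2 := by simp only [ht'def]; ring
        rw [e]; linarith [hτT n]
      have hsqrt : Real.sqrt ν * Real.sqrt (-s) / Mb n ≤ Real.sqrt (T - t') := by
        calc Real.sqrt ν * Real.sqrt (-s) / Mb n = Real.sqrt (ν * (-s) / Mb n ^ 2) := by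
              rw [Real.sqrt_div' _ hM2.le, Real.sqrt_mul hν.le, Real.sqrt_sq hM.le]
          _ ≤ Real.sqrt (T - t') := Real.sqrt_le_sqrt hTt'
      have hpos : 0 < Real.sqrt ν * Real.sqrt (-s) / Mb n := by positivity
      have h2 : 0 ≤ (Mb n)⁻¹ := by positivity
      have h3 : 0 ≤ Real.sqrt (-s) := Real.sqrt_nonneg _
      have hstep : C * Real.sqrt ν / Real.sqrt (T - t') ≤ C * Real.sqrt ν / (Real.sqrt ν * Real.sqrt (-s) / Mb n) :=
        div_le_div_of_nonneg_left (mul_nonneg hC0 hsν.le) hpos hsqrt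
      calc Real.sqrt (-s) * ((Mb n)⁻¹ * ‖u t' ((ν / Mb n) • z)‖)
          ≤ Real.sqrt (-s) * ((Mb n)⁻¹ * (C * Real.sqrt ν / Real.sqrt (T - t'))) :=
            mul_le_mul_of_nonneg_left (mul_le_mul_of_nonneg_left (htypeI t' h1 ht'T _) h2) h3
        _ ≤ Real.sqrt (-s) * ((Mb n)⁻¹ * (C * Real.sqrt ν / (Real.sqrt ν * Real.sqrt (-s) / Mb n))) :=
            mul_le_mul_of_nonneg_left (mul_le_mul_of_nonneg_left hstep h2) h3
        _ = C := by field_simp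
        _ ≤ K := le_max_left _ _
  -- late indices: `t n > T/2`, so that the zoom window reaches back past `2 s₀`
  obtain ⟨n₀, hn₀⟩ : ∃ n₀ : ℕ, ∀ n, n₀ ≤ n → T / 2 < t n := by
    have h : ∀ᶠ n in atTop, t n ∈ Set.Ioi (T / 2) := htT (Ioi_mem_nhds (by linarith))
    exact eventually_atTop.1 h
  -- the uniform window constants: bound `N` on `[2s₀, s₀/2]`, window `[0, S]` after translating by `2s₀`, interior time `−s₀`
  set N : ℝ := K / Real.sqrt (-s₀ / 2) with hNdef
  have hs₀2 : 0 < -s₀ / 2 := by linarith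
  have hN0 : 0 ≤ N := div_nonneg hK0 (Real.sqrt_nonneg _)
  set S : ℝ := -(3 * s₀ / 2) with hSdef
  have hSpos : 0 < S := by rw [hSdef]; linarith
  have htstar0 : 0 < -s₀ := by linarith
  have htstarS : -s₀ < S := by rw [hSdef]; linarith
  refine ⟨n₀, fun k => ?_⟩
  obtain ⟨Λ, hΛ0, hΛ⟩ := iteratedFDeriv_bound_of_oseenWindow k hN0 htstar0 htstarS
  refine ⟨Λ, hΛ0, fun n hn x => ?_⟩
  -- the zoom with vertex `τ n`, centre `0`, space scale `lam = ν / Mb n`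
  have hM := hMbpos n
  set lam : ℝ := ν / Mb n with hlamdef
  have hlam : 0 < lam := div_pos hν hM
  have hlam1 : lam / ν = (Mb n)⁻¹ := by simp only [hlamdef]; field_simp
  have hlam2 : lam ^ 2 / ν = ν / Mb n ^ 2 := by simp only [hlamdef]; field_simp
  set w : ℝ → EuclideanSpace ℝ (Fin 3) → EuclideanSpace ℝ (Fin 3) :=
    (lam / ν) • stPull (lam ^ 2 / ν) lam (τ n) 0 u with hwdef
  have hZw : ∀ s z, (Mb n)⁻¹ • u (τ n + ν * s / Mb n ^ 2) ((ν / Mb n) • z) = w s z := by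
    intro s z
    show _ = ((lam / ν) • stPull (lam ^ 2 / ν) lam (τ n) 0 u) s z
    rw [smul_stPull_apply, hlam1, hlam2, zero_add, show ν / Mb n ^ 2 * s = ν * s / Mb n ^ 2 by ring]
  set Aw : ℝ := -(τ n * ν / lam ^ 2) with hAwdef
  set Bw : ℝ := (T - τ n) * ν / lam ^ 2 with hBwdef
  have hAw : Aw = -(τ n * Mb n ^ 2 / ν) := by simp only [hAwdef, hlamdef]; field_simp
  have hBwpos : 0 < Bw := by
    simp only [hBwdef]; exact div_pos (mul_pos (sub_pos.2 (hτT n)) hν) (pow_pos hlam 2)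
  -- the window reaches `2 s₀`: `τ n (Mb n)²/ν > c₀² = −2 s₀` since `t n > T/2`
  have hAw2 : Aw < 2 * s₀ := by
    rw [hAw, hs₀def]
    have htn := hn₀ n hn
    have hM2 : 0 < Mb n ^ 2 := pow_pos hM 2
    have h1 : ν * c₀ ^ 2 < t n * Mb n ^ 2 := by
      calc ν * c₀ ^ 2 ≤ (T - t n) * Mb n ^ 2 := hsq n
        _ < t n * Mb n ^ 2 := by apply mul_lt_mul_of_pos_right _ hM2; linarith
    have h2 : c₀ ^ 2 < τ n * Mb n ^ 2 / ν := by
      rw [lt_div_iff₀ hν]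
      calc c₀ ^ 2 * ν = ν * c₀ ^ 2 := mul_comm _ _
        _ < t n * Mb n ^ 2 := h1
        _ ≤ τ n * Mb n ^ 2 := mul_le_mul_of_nonneg_right (hτge n).le hM2.le
    linarith
  -- the zoom is classical on its window and Oseen-mild there
  have hwcl : IsClassicalNSSolutionOn (Ioo Aw Bw) 1 0 w ((lam / ν) ^ 2 • stPull (lam ^ 2 / ν) lam (τ n) 0 p) :=
    zoom_isClassical_window (t₀ := τ n) (x₀ := 0) hν hsol hlam
  have hmildw : ∀ s t' : ℝ, Aw < s → s < t' → t' < 0 → ∀ z,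
      w t' z = heatExtension (w s) (t' - s) z - oseenDuhamel 1 s w w t' z :=
    fun s t' hs hst ht' z =>
      zoom_oseen_window (t₀ := τ n) (x₀ := 0) hν hT hsol hLH hbdd hlam hs hst (ht'.trans hBwpos) z
  have hbdw : ∀ s, 2 * s₀ ≤ s → s ≤ s₀ / 2 → ∀ z, ‖w s z‖ ≤ N := by
    intro s hs1 hs2 z
    have hsneg : s < 0 := by linarith
    have hsA : -(τ n * Mb n ^ 2 / ν) < s := by rw [← hAw]; linarith
    have h := hzoomI n s hsA hsneg z
    rw [hZw s z] at h
    have hss : 0 < Real.sqrt (-s) := Real.sqrt_pos.2 (by linarith)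
    have h1 : ‖w s z‖ ≤ K / Real.sqrt (-s) := by rw [le_div_iff₀ hss, mul_comm]; exact h
    refine h1.trans ?_
    rw [hNdef]
    exact div_le_div_of_nonneg_left hK0 (Real.sqrt_pos.2 hs₀2) (Real.sqrt_le_sqrt (by linarith))
  -- the translated window field `U r = w (r + 2 s₀)` on `[0, S]`
  set a : ℝ := 2 * s₀ with hadef
  set Uw : ℝ → EuclideanSpace ℝ (Fin 3) → EuclideanSpace ℝ (Fin 3) := fun r => w (r + a) with hUwdef
  have hwin : ∀ r ∈ Icc 0 S, Aw < r + a ∧ r + a ≤ s₀ / 2 := by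
    intro r hr
    refine ⟨by linarith [hr.1], ?_⟩
    have := hr.2; rw [hSdef] at this; rw [hadef]; linarith
  have hneg : ∀ r ∈ Icc 0 S, r + a < 0 := fun r hr => by linarith [(hwin r hr).2]
  have hcontU : ContinuousOn (uncurry Uw) (Icc 0 S ×ˢ univ) := by
    have hc : ContinuousOn (uncurry w) (Ioo Aw Bw ×ˢ univ) := hwcl.smooth_velocity.continuousOn
    have hmap : Continuous fun q : ℝ × EuclideanSpace ℝ (Fin 3) => (q.1 + a, q.2) := by fun_prop
    have hinto : MapsTo (fun q : ℝ × EuclideanSpace ℝ (Fin 3) => (q.1 + a, q.2)) (Icc 0 S ×ˢ univ) (Ioo Aw Bw ×ˢ univ) :=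
      fun q hq => ⟨⟨(hwin q.1 hq.1).1, (hneg q.1 hq.1).trans hBwpos⟩, mem_univ _⟩
    exact (hc.comp hmap.continuousOn hinto).congr fun q _ => rfl
  have hKU : ∀ r ∈ Icc 0 S, ∀ z, ‖Uw r z‖ ≤ N := fun r hr z =>
    hbdw (r + a) (by rw [hadef]; linarith [hr.1]) (hwin r hr).2 z
  have hdivU : ∀ r ∈ Icc 0 S, IsWeaklyDivFree (Uw r) := by
    intro r hr
    have hsI : r + a ∈ Ioo Aw Bw := ⟨(hwin r hr).1, (hneg r hr).trans hBwpos⟩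
    exact VectorCalculus.IsDivFree.isWeaklyDivFree_holds (hwcl.divFree _ hsI)
      ((hwcl.contDiff_velocity hsI).of_le (by exact_mod_cast le_top))
  have hmildU : ∀ s t' : ℝ, 0 ≤ s → s < t' → t' ≤ S → ∀ z,
      Uw t' z = heatExtension (Uw s) (t' - s) z - oseenDuhamel 1 s Uw Uw t' z := by
    intro s t' hs hst htS z
    have h := hmildw (s + a) (t' + a) (hwin s ⟨hs, hst.le.trans htS⟩).1 (by linarith)
      (hneg t' ⟨hs.trans hst.le, htS⟩) z
    have hts : t' + a - (s + a) = t' - s := by ring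
    rw [hts] at h
    rw [show Uw t' z = w (t' + a) z from rfl, h, oseenDuhamel_translate 1 s a w w t' z]
  have hbound := hΛ Uw hcontU hKU hdivU hmildU x
  -- identify the slice: `Uw (−s₀) = w s₀ = the zoomed slice`
  have hslice : Uw (-s₀) = fun y => (Mb n)⁻¹ • u (t n) ((ν / Mb n) • y) := by
    funext y
    show w (-s₀ + a) y = _
    rw [show -s₀ + a = s₀ by rw [hadef]; ring, ← hZw s₀ y, hτt n]
  rw [hslice] at hbound
  exact hbound

end Summit.NavierStokesRegularity.NavierStokesRegularity.Theorems.ExtremiserTransience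

end
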